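import Summits.AtomisticToContinuum.Crystallization.Theorems.ReggeStarCoercivityStabilityConstantTwelveNegDFourRows

/-!
# Route `ReggeStarCoercivity`, crux `StabilityConstantTwelve` (stmt-AtomisticToContinuum-13601) —
# negative side III-b: `D₄` certificate, row block 4 of 5

Kernel-decided partial sum (`decide +kernel` on `ℚ`, no `native_decide`, standard axioms; ≤ 60 s) of the
409-point `D₄`-ball certificate at scale `s = 23/50` (`…NegDFourRows.lean`); verbatim port of
`Cruxes/StabilityConstantTwelve/DisproofHeavyD4.lean` (`HeavyD4.d4_block4`), one block per module so that
each module stays inside the gate's per-module elaboration budget.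
-/

noncomputable section

namespace Summit.AtomisticToContinuum.Crystallization.Theorems.StabilityConstantTwelveNegative

open Cert

set_option maxHeartbeats 40000000 in
/-- rows 328–408 (kernel-decided). -/
theorem d4_block4 : hsumB (d4Rows.drop 328) d4Rows (23 / 50) ≤ -14827 / 100 := by decide +kernel

end Summit.AtomisticToContinuum.Crystallization.Theorems.StabilityConstantTwelveNegative

end
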